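import Mathlib.Algebra.BigOperators.Ring.Finset
import Mathlib.Logic.Equiv.Prod
import Literature.Computability.Complexity.AverageCaseDepthHierarchy
import Literature.Computability.Complexity.CircuitInputMap
import HarnessLib

/-!
# Aaronson–Chen 2017, Lemma 5.5: `Sipser_d ∘ OR` is hard on average under `𝒟_n` (the finite core)

S. Aaronson, L. Chen, CCC 2017 (arXiv:1612.05903) [AaronsonChen2017], **Lemma 5.5** (p. 24):
for `N = 2ⁿ` and the `N`-variable `Sipser_d`, the function `(Sipser_d ∘ OR)(x) := Sipser_d(z)`,
`z_i := ⋁_{j=(i-1)N+1}^{iN} x_j` on `{0,1}^{N²}` satisfies: "any circuit `C'` of depth at most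
`d - 1` and size at most `S = 2^{N^{1/(6(d-1))}}` over `{0,1}^{N²}` agrees with `(Sipser_d ∘ OR)`
with probability at most `1/2 + N^{-Ω(1/d)}` when inputs are drawn from the distribution `𝒟_n`"
(each block all-zero with probability `1/2`, else a single `1` at a uniformly random position).
Printed proof: `𝒟_n` is the average, over the hidden positions `y = (y_1, …, y_N)`, of the
distributions `𝒟_n^y` (independent fair bits at the positions `(i-1)N + y_i`, zeros elsewhere);
on the support of `𝒟_n^y`, `(Sipser_d ∘ OR)(x) = Sipser_d(x_{y_1}, …, x_{(N-1)N+y_N})`; an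
averaging argument picks `y`; "Setting `x_{(i-1)N+y_i} = z_i` for each `i`, and all other inputs
to `0` in the circuit `C`, we then have a circuit `D` of size at most `S` and depth at most `d - 1`
over `{0,1}^N`" agreeing with `Sipser_d` too often, contradicting Thm. 5.4 (= RST Thm. 1).

This file proves that argument as a REDUCTION between finite correlation bounds, for an arbitrary
fan-in sequence `ws` (blocks indexed by the leaves `Addr ws` themselves — Aaronson–Chen's
"`N`-variable `Sipser_d` with `N = 2ⁿ`" does not literally exist for RST's `n = w₀ w^{d-2} m`, and
the application uses `Sipser_d` on its own leaves with an injective block assignment) and an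
arbitrary finite set `π` of positions per block:

* `blockWin c` — the window (`Addr ws × π → Bool`) of a *level readout* `c : Addr ws → π × Bool`
  (hidden position and block bit of every block): bit `(a, j)` is on iff block `a` is on and `j`
  is its hidden position; the uniform distribution on readouts induces `𝒟_n` on windows;
* `sipserOr ws root w := sipserEval ws root (fun a ↦ ⋁ⱼ w (a, j))` — `Sipser ∘ OR`;
* `CorrBound ws root dep S θ` — "every `acBasis` circuit of `acDepth ≤ dep` and `size ≤ S` on the
  leaves agrees with the formula `sipserEval ws root` on at most `θ · 2ⁿ` inputs" (the shape of
  RST Thm. 1's conclusion, `θ = 1/2 + n^{-C/d}`);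
* `lemma55_finite` — **Lemma 5.5, finite form**: `CorrBound ws root dep S θ` implies that every
  such circuit on the window variables `Addr ws × π` agrees with `sipserOr` on at most
  `θ · |π|ⁿ · 2ⁿ` of the `(2|π|)ⁿ` readouts, i.e. with `𝒟_n`-probability at most `θ`
  (`dep, S ≥ 1`). Proof as printed: sum over `y`, and for fixed `y` the window of `(y, u)` is the
  projection `x_{(a, y_a)} := u_a`, other inputs `0`, of `u` (`Circuit.exists_project`,
  `CircuitInputMap.lean`), on which `sipserOr` is `sipserEval` of `u`.

The probabilistic wrapping (the readout of a level of `O ∼ 𝒟_O` is uniform and independent of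
the rest of the oracle) and the choice of RST's fan-ins are in the sibling files
`AaronsonChenPHMeasure.lean`, `AaronsonChenPHLowerBound.lean`.

## Sources

* [AaronsonChen2017] arXiv:1612.05903, `lit read` p. 24: Lemma 5.5 and its proof
  (`𝒟_n^{y_1,…,y_N}`, the averaging argument, the projected circuit `D`).
-/

noncomputable section

namespace Literature.Barriers.QuantumAdvantage

open Finset Literature.Computability.Complexity

variable {ws : List ℕ} {π : Type*}

/-! ### Windows of level readouts and `Sipser ∘ OR` -/

/-- The window of a level readout `c` (for each block `a`: its hidden position `(c a).1` and its
block bit `(c a).2`): the bit at position `j` of block `a` is on iff the block is on and `j` is the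
hidden position — a sample of `𝒟_n^{y}` with `y = (c ·).1` and fair bits `(c ·).2`.
[cite: AaronsonChen2017, §5.2 (𝒟_n, p. 20) and proof of Lemma 5.5 (𝒟_n^{y_1,…,y_N}, p. 24)] -/
def blockWin [DecidableEq π] (c : Addr ws → π × Bool) : Addr ws × π → Bool :=
  fun p => (c p.1).2 && decide (p.2 = (c p.1).1)

/-- `(Sipser ∘ OR)(w) := Sipser(z)`, `z_a := ⋁ⱼ w (a, j)`: the read-once alternating formula with
fan-ins `ws` and root type `root` on the block-ORs of the window. [cite: AaronsonChen2017, Lemma 5.5 (p. 24)] -/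
def sipserOr [Fintype π] (ws : List ℕ) (root : Bool) (w : Addr ws × π → Bool) : Bool :=
  sipserEval ws root fun a => decide (∃ j : π, w (a, j) = true)

/-- On the window of the readout `(y, u)` the block-ORs are the block bits `u`, so
`(Sipser ∘ OR)` is `Sipser(u)` ("for all `x` in the support of `𝒟_n^{y}`,
`(Sipser_d ∘ OR)(x) = Sipser_d(x_{y_1}, …, x_{(N-1)N+y_N})`"). [cite: AaronsonChen2017, proof of Lemma 5.5 (p. 24)] -/
theorem sipserOr_blockWin [Fintype π] [DecidableEq π] (root : Bool) (y : Addr ws → π)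
    (u : Addr ws → Bool) :
    sipserOr ws root (blockWin fun a => (y a, u a)) = sipserEval ws root u := by
  unfold sipserOr
  congr 1
  funext a
  have h : (∃ j : π, blockWin (fun a => (y a, u a)) (a, j) = true) ↔ u a = true := by
    constructor
    · rintro ⟨j, hj⟩
      simp only [blockWin, Bool.and_eq_true] at hj
      exact hj.1
    · intro hu
      exact ⟨y a, by simp [blockWin, hu]⟩
  rw [Bool.decide_congr h, Bool.decide_eq_true]

/-- The projection realising the window of `(y, u)` from `u`: keep the input `(a, y_a)`, set all
other inputs of block `a` to `0` ("Setting `x_{(i-1)N+y_i} = z_i` for each `i`, and all other inputs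
to `0`"). [cite: AaronsonChen2017, proof of Lemma 5.5 (p. 24)] -/
def posRestr [DecidableEq π] (y : Addr ws → π) : Addr ws × π → Option Bool :=
  fun p => if p.2 = y p.1 then none else some false

/-- Restricting `(a, j) ↦ u_a` by `posRestr y` gives the window of `(y, u)`. [cite: AaronsonChen2017, proof of Lemma 5.5 (p. 24)] -/
theorem restrictInput_posRestr [DecidableEq π] (y : Addr ws → π) (u : Addr ws → Bool) :
    restrictInput (posRestr y) (fun p : Addr ws × π => u p.1) = blockWin fun a => (y a, u a) := by
  funext p
  unfold restrictInput posRestr blockWin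
  by_cases h : p.2 = y p.1
  · simp [h]
  · simp [h]

/-! ### Correlation bounds and Lemma 5.5 (finite form) -/

/-- `CorrBound ws root dep S θ`: every circuit over `acBasis` of `acDepth ≤ dep` and at most `S`
gates on the leaves `Addr ws` agrees with the formula `sipserEval ws root` on at most `θ · 2ⁿ`
leaf assignments (`n = ∏ ws`) — the shape of the conclusion of RST's Theorem 1
(`rossmanServedioTan2015_thm1`: `ws = rstFanins m d`, `dep = d - 1`, `θ = 1/2 + n^{-C/d}`).
[cite: RossmanServedioTan2015, Thm. 1 (p. 3)] -/
def CorrBound (ws : List ℕ) (root : Bool) (dep S : ℕ) (θ : ℝ) : Prop :=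
  ∀ D : Circuit (Addr ws), D.IsOver acBasis → D.acDepth ≤ dep → D.size ≤ S →
    (((univ : Finset (Addr ws → Bool)).filter fun u => D.eval u = sipserEval ws root u).card : ℝ) ≤
      θ * 2 ^ ws.prod

/-- For a fixed vector of hidden positions `y`, the agreements of `C` with `Sipser ∘ OR` on the
windows of the readouts `(y, ·)` are the agreements of the projected circuit `D` with `Sipser`
(`D(u) = C(x)` with `x_{(a, y_a)} = u_a`, other inputs `0`; `D` has at most `max |C| 1` gates and
`acDepth ≤ max (acDepth C) 1`). [cite: AaronsonChen2017, proof of Lemma 5.5 (p. 24)] -/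
theorem card_agree_blockWin_le [Fintype π] [DecidableEq π] {root : Bool} {dep S : ℕ} {θ : ℝ}
    (h : CorrBound ws root dep S θ) (hdep : 1 ≤ dep) (hS : 1 ≤ S) (C : Circuit (Addr ws × π))
    (hB : C.IsOver acBasis) (hd : C.acDepth ≤ dep) (hs : C.size ≤ S) (y : Addr ws → π) :
    (((univ : Finset (Addr ws → Bool)).filter fun u =>
        C.eval (blockWin fun a => (y a, u a)) = sipserOr ws root (blockWin fun a => (y a, u a))).card : ℝ) ≤
      θ * 2 ^ ws.prod := by
  obtain ⟨D, hDB, hDs, hDd, hDev⟩ := C.exists_project hB (posRestr y) (Prod.fst : Addr ws × π → Addr ws)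
  have hset : ((univ : Finset (Addr ws → Bool)).filter fun u =>
        C.eval (blockWin fun a => (y a, u a)) = sipserOr ws root (blockWin fun a => (y a, u a))) =
      (univ : Finset (Addr ws → Bool)).filter fun u => D.eval u = sipserEval ws root u := by
    refine Finset.filter_congr fun u _ => ?_
    rw [hDev u, restrictInput_posRestr, sipserOr_blockWin]
  rw [hset]
  exact h D hDB (hDd.trans (max_le hd hdep)) (hDs.trans (max_le hs hS))

/-- **Aaronson–Chen 2017, Lemma 5.5 (finite form).** If every depth-`dep` size-`S` circuit on the
leaves agrees with `Sipser` on at most `θ · 2ⁿ` inputs (`CorrBound`, e.g. RST Thm. 1), then every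
depth-`dep` size-`S` circuit `C` on the window variables `Addr ws × π` agrees with `Sipser ∘ OR`
on the windows of at most `θ · |π|ⁿ · 2ⁿ` of the `(2|π|)ⁿ` level readouts — i.e. with probability
at most `θ` when the window is drawn from `𝒟_n` (uniform readout). Printed proof: average over
the hidden positions `y` (`𝒟_n = N^{-N} ∑_y 𝒟_n^y`) and project (`card_agree_blockWin_le`).
[cite: AaronsonChen2017, Lemma 5.5 and its proof (p. 24)] -/
theorem lemma55_finite [Fintype π] [DecidableEq π] {root : Bool} {dep S : ℕ} {θ : ℝ}
    (h : CorrBound ws root dep S θ) (hdep : 1 ≤ dep) (hS : 1 ≤ S) (C : Circuit (Addr ws × π))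
    (hB : C.IsOver acBasis) (hd : C.acDepth ≤ dep) (hs : C.size ≤ S) :
    (((univ : Finset (Addr ws → π × Bool)).filter fun c =>
        C.eval (blockWin c) = sipserOr ws root (blockWin c)).card : ℝ) ≤
      θ * ((Fintype.card π : ℝ) ^ ws.prod * 2 ^ ws.prod) := by
  classical
  -- the agreement indicator, summed over readouts `c ↔ (y, u)`
  set P : (Addr ws → π × Bool) → Prop := fun c => C.eval (blockWin c) = sipserOr ws root (blockWin c)
    with hP
  have hsum : (((univ : Finset (Addr ws → π × Bool)).filter P).card : ℝ) =
      ∑ y : Addr ws → π, (((univ : Finset (Addr ws → Bool)).filter fun u =>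
        P fun a => (y a, u a)).card : ℝ) := by
    have h1 : (((univ : Finset (Addr ws → π × Bool)).filter P).card : ℝ) =
        ∑ c : Addr ws → π × Bool, (if P c then (1 : ℝ) else 0) := by
      rw [Finset.natCast_card_filter]
    have h2 : ∑ c : Addr ws → π × Bool, (if P c then (1 : ℝ) else 0) =
        ∑ q : (Addr ws → π) × (Addr ws → Bool), (if P (fun a => (q.1 a, q.2 a)) then (1 : ℝ) else 0) := by
      exact Fintype.sum_equiv (Equiv.arrowProdEquivProdArrow (Addr ws) (fun _ => π) fun _ => Bool) _ _
        fun c => rfl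
    rw [h1, h2, Fintype.sum_prod_type]
    refine Finset.sum_congr rfl fun y _ => ?_
    rw [Finset.natCast_card_filter]
  rw [hsum]
  calc ∑ y : Addr ws → π, (((univ : Finset (Addr ws → Bool)).filter fun u => P fun a => (y a, u a)).card : ℝ)
      ≤ ∑ _y : Addr ws → π, θ * 2 ^ ws.prod :=
        Finset.sum_le_sum fun y _ => card_agree_blockWin_le h hdep hS C hB hd hs y
    _ = θ * ((Fintype.card π : ℝ) ^ ws.prod * 2 ^ ws.prod) := by
        rw [Finset.sum_const, Finset.card_univ, Fintype.card_fun, Addr.card, nsmul_eq_mul]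
        push_cast
        ring

/-- The same bound read as a probability: the fraction of level readouts on whose window `C`
agrees with `Sipser ∘ OR` is at most `θ`. [cite: AaronsonChen2017, Lemma 5.5 (p. 24)] -/
theorem lemma55_finite_div [Fintype π] [DecidableEq π] [Nonempty π] {root : Bool} {dep S : ℕ}
    {θ : ℝ} (h : CorrBound ws root dep S θ) (hdep : 1 ≤ dep) (hS : 1 ≤ S)
    (C : Circuit (Addr ws × π)) (hB : C.IsOver acBasis) (hd : C.acDepth ≤ dep) (hs : C.size ≤ S) :
    (((univ : Finset (Addr ws → π × Bool)).filter fun c =>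
        C.eval (blockWin c) = sipserOr ws root (blockWin c)).card : ℝ) /
        Fintype.card (Addr ws → π × Bool) ≤ θ := by
  have hcard : (Fintype.card (Addr ws → π × Bool) : ℝ) = (Fintype.card π : ℝ) ^ ws.prod * 2 ^ ws.prod := by
    rw [Fintype.card_fun, Fintype.card_prod, Fintype.card_bool, Addr.card]
    push_cast
    ring
  have hpos : (0 : ℝ) < Fintype.card (Addr ws → π × Bool) := by
    exact_mod_cast Fintype.card_pos
  rw [div_le_iff₀ hpos, hcard]
  exact lemma55_finite h hdep hS C hB hd hs

end Literature.Barriers.QuantumAdvantage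

end
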